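import Summits.QuantumAdvantage.AdviceFreeQNC0.OddPrimeTransport
import Summits.QuantumAdvantage.QuantumAdvantage.Theorems.RingFrameBridge
import HarnessLib

/-!
# Cell qa-qnc0 (odd primes): the ladder `WalkHardF p → AdviceFreeQNC0Sep p` for every prime `p`

Planner qa-qnc0-p2 g12, `Sketch12b.lean` §8 `ladder_odd` (verbatim) composed with the PROVED inputs P7
(`RingHardOdd.ringHardOfOdd`, seat qa-qnc0-prover-2) and P8 (`OddPrimeTransport.walkTransportF`):

* `ladder_odd` — `WalkTransportF p → RingHardOfOdd p → WalkHardF p → AdviceFreeQNC0Sep p` through the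
  LANDED bridge `Theorems.adviceFreeQNC0Sep_of_ringHard` (route RingFrame, item `BridgeRingToSep`, every `p`);
* **`adviceFreeQNC0Sep_of_walkHardF : WalkHardF p → AdviceFreeQNC0Sep p`** — for EVERY prime the advice-free
  separation "2D HLF ∉ `FAC⁰[p]/rpoly` (uniform random bits, constant gap)" is ONE statement away: walk
  hardness of α's u-game against `𝔽_p`-degree-polylog players.  At `p = 2` the hypothesis is the theorem
  `walkHardF_two` (and the conclusion is rung F-Q1, `adviceFreeQNC0`); at `p = 3` it is FALSE
  (`OddPrimeWitnesses.not_walkHardF_three`); for `p ≥ 5` it is the cell's open crux (ROUND-12 §B.5–B.6).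

Kept apart from `OddPrimeTransport.lean` because the bridge module imports the route file `Theses.RingFrame`
(theses-cone lint); nothing else here.  WHAT THIS IS NOT: no separation for any odd `p` is proved.
-/

namespace Summit.QuantumAdvantage.AdviceFreeQNC0

/-- The odd-prime ladder for `p ≥ 5` (composition; Sketch12b §8 `ladder_odd`, verbatim): walk hardness
over `𝔽_p` ⇒ the advice-free separation against `AC⁰[p]/rpoly`, through `RingHardOdd p → RingHard p`
(P7) and the LANDED bridge `adviceFreeQNC0Sep_of_ringHard`. -/
theorem ladder_odd (p : ℕ) [Fact p.Prime] (h₁ : WalkTransportF p) (h₂ : RingHardOfOdd p)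
    (h : WalkHardF p) : AdviceFreeQNC0Sep p :=
  Summit.QuantumAdvantage.QuantumAdvantage.Theorems.adviceFreeQNC0Sep_of_ringHard p (h₂ (h₁ h))

/-- **For every prime `p`, the advice-free separation `AdviceFreeQNC0Sep p` (2D HLF vs `FAC⁰[p]/rpoly`,
constant gap) follows from ONE statement, walk hardness `WalkHardF p`** (P7, P8 discharged:
`ringHardOfOdd`, `walkTransportF`).  For `p = 2` the hypothesis is `walkHardF_two`; for `p = 3` it is FALSE
(`OddPrimeWitnesses.not_walkHardF_three`); for `p ≥ 5` it is the cell's open crux. -/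
theorem adviceFreeQNC0Sep_of_walkHardF (p : ℕ) [Fact p.Prime] (h : WalkHardF p) :
    AdviceFreeQNC0Sep p :=
  ladder_odd p (walkTransportF p) (ringHardOfOdd p) h

/-- Sanity re-derivation of α's `RingHard 2` through the odd-prime chain (`P7 ∘ P8` at `p = 2`). -/
theorem ringHard_two_of_oddChain : RingHard 2 := ringHardOfOdd 2 ringHardOdd_two

/-- Sanity instance at `p = 2`: rung F-Q1's statement `AdviceFreeQNC0Sep 2` through the odd-prime ladder. -/
theorem adviceFreeQNC0Sep_two_of_oddChain : AdviceFreeQNC0Sep 2 :=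
  adviceFreeQNC0Sep_of_walkHardF 2 walkHardF_two

end Summit.QuantumAdvantage.AdviceFreeQNC0
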